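import Mathlib

/-!
# SoloBlindPhiTrichotomy — valuation bookkeeping of the order-9 node functional (solo-blind s140)

WILD88, proviso P4.  The free-coordinate engine (HOME/work/s140/phi_free.py, LEMMA FAR-9 / E13-FREE)
shows that, with the satellite coordinate `ũ` at scale `σ`, `λ = t σ³` and the K-digit `δ` at `σ⁴`, the
node functional has no `ũ`-dependence below `σ⁹` and
`[σ⁹] N = ⟨δ², ũ⟩ + 2 t Q_δ(ũ) + t² e₃(ũ) + (ũ-free)`,
the three pieces having `(t-degree, u-degree) = (0,1), (1,2), (2,3)`.  On the stratum of K-valuation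
`e ≤ 1/3` one has `v(σ) = e/4`, `v(t) = (1 − 3e)/4`, so the pieces have valuations
`vL = 9e/4`, `vQ = 6e/4 + 1/4`, `vE = 3e/4 + 1/2`, and a general monomial `σ^o t^j (…)` has valuation
`(o − 3j) e/4 + j/4`.  This file certifies the elementary inequalities behind the Φ₉-TRICHOTOMY
(HOME/work/s140/far72.md §2): for `e < 1/3` the linear piece `⟨δ²,ũ⟩` is the unique `ũ`-dependent term of
minimal valuation among all monomials of `σ`-order `≥ 9` (and the uncomputed tail `o ≥ 12` is harmless),
at `e = 1/3` the three pieces tie at `3/4` (the critical stratum E13), and for `e > 1/3` the cubic `e₃` wins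
(the far regime, THEOREM FAR-72).  It also certifies the algebraic fact used by PROPOSITION E-UNIFORM-30:
the level form `u ↦ Σ δᵢ² uᵢ` is nonzero on the plane `Σ uᵢ = 0` whenever `δ ≠ 0`, `Σ δᵢ = 0` and `3 ≠ 0`
(so its level sets on the 25-point Artin–Schreier set, an `𝔽₅`-plane, have at most 5 points).
Memo: HOME/work/s140/far72.md §2, §5; claims SB-C1111, SB-C1115.
-/

namespace Summit.HodgeConjecture.HodgeConjecture.Theorems

/-- Valuation of the linear piece `σ⁹ ⟨δ², ũ⟩` on the stratum of K-valuation `e`. -/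
def trichVL (e : ℚ) : ℚ := 9 * e / 4

/-- Valuation of the quadratic piece `σ⁹ · 2 t Q_δ`. -/
def trichVQ (e : ℚ) : ℚ := 6 * e / 4 + 1 / 4

/-- Valuation of the cubic piece `σ⁹ · t² e₃`. -/
def trichVE (e : ℚ) : ℚ := 3 * e / 4 + 1 / 2

/-- Valuation of a general monomial `σ^o t^j` (all other symbols integral units). -/
def trichVMon (e : ℚ) (o j : ℕ) : ℚ := ((o : ℚ) - 3 * j) * e / 4 + j / 4

/-- The three pieces are the monomials `(o, j) = (9, 0), (9, 1), (9, 2)`. -/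
theorem trichVMon_nine (e : ℚ) :
    trichVMon e 9 0 = trichVL e ∧ trichVMon e 9 1 = trichVQ e ∧ trichVMon e 9 2 = trichVE e := by
  unfold trichVMon trichVL trichVQ trichVE
  refine ⟨by ring, by push_cast; ring, by push_cast; ring⟩

/-- Below the critical stratum (`e < 1/3`) the linear piece has the smallest valuation. -/
theorem trich_below (e : ℚ) (he : e < 1 / 3) :
    trichVL e < trichVQ e ∧ trichVL e < trichVE e := by
  unfold trichVL trichVQ trichVE
  constructor <;> linarith

/-- On the critical stratum `e = 1/3` the three pieces tie at valuation `3/4` (E13). -/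
theorem trich_critical : trichVL (1 / 3) = 3 / 4 ∧ trichVQ (1 / 3) = 3 / 4 ∧ trichVE (1 / 3) = 3 / 4 := by
  unfold trichVL trichVQ trichVE
  norm_num

/-- Above the critical stratum (`e > 1/3`, before renormalising to the far scaling) the cubic piece `e₃`
has the smallest valuation (the far regime). -/
theorem trich_above (e : ℚ) (he : 1 / 3 < e) :
    trichVE e < trichVQ e ∧ trichVE e < trichVL e := by
  unfold trichVL trichVQ trichVE
  constructor <;> linarith

/-- The three pairwise ties all happen exactly at `e = 1/3`. -/
theorem trich_tie_iff (e : ℚ) :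
    (trichVL e = trichVQ e ↔ e = 1 / 3) ∧ (trichVL e = trichVE e ↔ e = 1 / 3) ∧
      (trichVQ e = trichVE e ↔ e = 1 / 3) := by
  unfold trichVL trichVQ trichVE
  refine ⟨⟨fun h => by linarith, fun h => by subst h; norm_num⟩,
    ⟨fun h => by linarith, fun h => by subst h; norm_num⟩,
    ⟨fun h => by linarith, fun h => by subst h; norm_num⟩⟩

/-- UNIQUENESS of the deciding term for `0 < e < 1/3`: every monomial of `σ`-order `o ≥ 9` with
`3 j ≤ o` (the symbol `t` only occurs inside `λ = t σ³`) other than `(o, j) = (9, 0)` has valuation strictly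
larger than `9e/4`. -/
theorem trich_unique_min (e : ℚ) (he0 : 0 < e) (he : e < 1 / 3) (o j : ℕ) (ho : 9 ≤ o)
    (hne : ¬ (o = 9 ∧ j = 0)) : trichVL e < trichVMon e o j := by
  unfold trichVL trichVMon
  have ho' : (9 : ℚ) ≤ o := by exact_mod_cast ho
  have hj0 : (0 : ℚ) ≤ j := by exact_mod_cast Nat.zero_le j
  have h1 : (0 : ℚ) ≤ ((o : ℚ) - 9) * e := mul_nonneg (by linarith) he0.le
  have h2 : (0 : ℚ) ≤ (j : ℚ) * (1 - 3 * e) := mul_nonneg hj0 (by linarith)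
  rcases Nat.eq_zero_or_pos j with hj | hj
  · subst hj
    have ho10 : 10 ≤ o := by omega
    have ho10' : (10 : ℚ) ≤ o := by exact_mod_cast ho10
    have h3 : e ≤ ((o : ℚ) - 9) * e := by nlinarith
    push_cast
    nlinarith
  · have hj1 : (1 : ℚ) ≤ j := by exact_mod_cast hj
    have h3 : (1 - 3 * e) ≤ (j : ℚ) * (1 - 3 * e) := by nlinarith
    nlinarith

/-- The uncomputed tail (`σ`-order `o ≥ 12`) lies strictly above the deciding valuation for
`0 < e < 1/3`. -/
theorem trich_tail (e : ℚ) (he0 : 0 < e) (he : e < 1 / 3) (o j : ℕ) (ho : 12 ≤ o) :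
    trichVL e < trichVMon e o j :=
  trich_unique_min e he0 he o j (by omega) (by omega)

/-- The deciding valuation stays inside the carry-free range (`< 1`, indeed `< 3/4`) for `e < 1/3`,
and equals `3/4 < 1` in the far scaling. -/
theorem trich_carry_safe (e : ℚ) (he : e < 1 / 3) : trichVL e < 3 / 4 ∧ (3 : ℚ) / 4 < 1 := by
  unfold trichVL
  constructor
  · linarith
  · norm_num

/-- FAR SHIFT: with the K-digit at level `m > 4` the two `δ`-pieces move to orders `9 + (m − 4)` and
`9 + 2 (m − 4)`, both strictly above `9`, so `e₃` is the only `ũ`-dependent order-9 term. -/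
theorem far_shift (m : ℚ) (hm : 4 < m) : (9 : ℚ) < 9 + (m - 4) ∧ (9 : ℚ) < 9 + 2 * (m - 4) := by
  constructor <;> linarith

/-- LEVEL FORM (E-UNIFORM-30): over a field with `3 ≠ 0`, if `δ₀ + δ₁ + δ₂ = 0` and the level form
`u ↦ Σ δᵢ² uᵢ` vanishes on the plane `Σ uᵢ = 0` — equivalently on its basis `(1,−1,0)`, `(0,1,−1)`, i.e.
`δ₀² = δ₁²` and `δ₁² = δ₂²` — then `δ = 0`. -/
theorem levelForm_eq_zero {K : Type*} [Field K] (h3 : (3 : K) ≠ 0) (d₀ d₁ d₂ : K)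
    (hs : d₀ + d₁ + d₂ = 0) (h01 : d₀ ^ 2 = d₁ ^ 2) (h12 : d₁ ^ 2 = d₂ ^ 2) :
    d₀ = 0 ∧ d₁ = 0 ∧ d₂ = 0 := by
  have hd₁ : d₁ = 0 := by
    rcases (sq_eq_sq_iff_eq_or_eq_neg).1 h01 with h0 | h0 <;>
      rcases (sq_eq_sq_iff_eq_or_eq_neg).1 h12.symm with h2 | h2
    · -- d₀ = d₁, d₂ = d₁
      have h : (3 : K) * d₁ = 0 := by linear_combination hs + (-1 : K) * h0 + (-1 : K) * h2
      exact (mul_eq_zero.1 h).resolve_left h3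
    · -- d₀ = d₁, d₂ = -d₁
      linear_combination hs + (-1 : K) * h0 + (-1 : K) * h2
    · -- d₀ = -d₁, d₂ = d₁
      linear_combination hs + (-1 : K) * h0 + (-1 : K) * h2
    · -- d₀ = -d₁, d₂ = -d₁
      have h : (-1 : K) * d₁ = 0 := by linear_combination hs + (-1 : K) * h0 + (-1 : K) * h2
      simpa using h
  subst hd₁
  have hd₀ : d₀ = 0 := by simpa using h01
  have hd₂ : d₂ = 0 := by
    have := h12.symm
    simpa using this
  exact ⟨hd₀, rfl, hd₂⟩

/-- In characteristic `5`, `3 ≠ 0`, so `levelForm_eq_zero` applies to the residue fields of WILD88. -/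
theorem three_ne_zero_of_charP_five {K : Type*} [Field K] [CharP K 5] : (3 : K) ≠ 0 := by
  intro h
  have h' : ((3 : ℕ) : K) = 0 := by exact_mod_cast h
  rw [CharP.cast_eq_zero_iff K 5] at h'
  omega

/-- Contrapositive form used in E-UNIFORM-30: a nonzero K-digit (`Σ δᵢ = 0`, some `δᵢ ≠ 0`) has a
level form that does not vanish on both basis vectors of the plane. -/
theorem levelForm_ne_zero {K : Type*} [Field K] [CharP K 5] (d₀ d₁ d₂ : K)
    (hs : d₀ + d₁ + d₂ = 0) (hd : d₀ ≠ 0 ∨ d₁ ≠ 0 ∨ d₂ ≠ 0) :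
    d₀ ^ 2 ≠ d₁ ^ 2 ∨ d₁ ^ 2 ≠ d₂ ^ 2 := by
  by_contra! h
  obtain ⟨h0, h1, h2⟩ := levelForm_eq_zero three_ne_zero_of_charP_five d₀ d₁ d₂ hs h.1 h.2
  rcases hd with hd | hd | hd <;> contradiction

/-- The arithmetic of E-UNIFORM-30 and FAR-72 against the target `92`. -/
theorem strata_node_bounds : 6 * 5 ≤ 92 ∧ 6 * 12 ≤ 92 ∧ 6 * 15 ≤ 92 := by decide

end Summit.HodgeConjecture.HodgeConjecture.Theorems
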